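import Summits.RiemannHypothesis.RiemannHypothesis.Theorems.WeilFormatCSectorBasis
import Summits.RiemannHypothesis.RiemannHypothesis.Theorems.WeilFormatCEntry
import HarnessLib

/-!
# Format C (Fourier–Galerkin certificates of Weil positivity): the Gram matrix on Yoshida's basis is
  REAL — the two landed packagings of the entries agree (polarisation)

Helper file (`--supports stmt-RiemannHypothesis-0098`, lead-track anchor), RH-free. Seat
rh-explicit-weil-3 (gen3). Inputs: weil-2's explicit entry theorem `weilWindowForm_sum_smul_chi_eq_explicit`
(`WeilFormatCEntry.lean`: `weilWindowForm a (Σ c_n χ_n) = Σ_{n,m} Re(conj c_n · c_m) · G(n,m)` with a REAL,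
explicit `G` — Yoshida 1992 (5.15)/(5.16)) and weil-3's Gram expansion `weilWindowForm_sum_smul`
(`WeilFormatCWindowGram.lean`: the same quantity `= Σ_{m,n} c_m conj(c_n) · weilWindowSesq a χ_m χ_n`).

* `im_eq_zero_of_re_hermitian_eq_real` (pure algebra, polarisation): if a hermitian kernel `S` and a real kernel
  `G` give the same real quadratic form `Re Σ c_p conj(c_q) S(p,q) = Σ Re(conj c_q c_p) G(q,p)` for all complex
  `c` on a finite set, then `Im S(m,n) = 0` on it (test vectors `δ_m`, `δ_n`, `δ_m + i δ_n`);
* **`im_weilWindowSesq_chi`**: `(weilWindowSesq a χ_m χ_n).im = 0` for all `m, n` (`a > 0`) — the `hreal`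
  hypothesis of `weilPositivityOn_of_real_gram_psd` / `…_real_gram_sector_psd` / `le_weilGroundEnergy_of_real_gram_margin`
  DISCHARGED once and for all;
* `im_weilWindowSesq_chiEven`, `im_weilWindowSesq_chiOdd`: the same for the sector bases (bilinearity), i.e. the
  `hrealE` / `hrealO` hypotheses of `weilPositivityOn_of_sectorBasis_real_gram_psd`;
* `weilPositivityOn_of_sectorBasis_psd`: the sector-basis dictionary with the reality hypotheses removed.
-/

set_option autoImplicit false
set_option linter.dupNamespace false  -- the mandated namespace repeats `RiemannHypothesis`

noncomputable section

open Complex Filter Set MeasureTheory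
open scoped Real Topology ComplexConjugate

namespace Summit.RiemannHypothesis.RiemannHypothesis.Theorems.WeilFormatC

open Literature.NumberTheory.LFunctions
open Literature.NumberTheory.LFunctions.Yoshida1992 (modes chi)

/-! ## Polarisation: a hermitian kernel with a real symmetric model has real entries -/

section Polar

variable {ι : Type*} [DecidableEq ι]

/-- Quadratic form of a kernel at a vector supported on one point. -/
private theorem sum_sum_single (s : Finset ι) (S : ι → ι → ℂ) {m : ι} (hm : m ∈ s) (z : ℂ) :
    ∑ p ∈ s, ∑ q ∈ s, (if p = m then z else 0) * conj (if q = m then z else 0) * S p q =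
      z * conj z * S m m := by
  rw [Finset.sum_eq_single_of_mem m hm (fun p _ hp ↦ by simp [hp])]
  rw [Finset.sum_eq_single_of_mem m hm (fun q _ hq ↦ by simp [hq])]
  simp

/-- Real quadratic form of a real kernel at a vector supported on one point. -/
private theorem sum_sum_single_real (s : Finset ι) (G : ι → ι → ℝ) {m : ι} (hm : m ∈ s) (z : ℂ) :
    ∑ q ∈ s, ∑ p ∈ s, (conj (if q = m then z else 0) * (if p = m then z else 0)).re * G q p =
      (conj z * z).re * G m m := by
  rw [Finset.sum_eq_single_of_mem m hm (fun q _ hq ↦ by simp [hq])]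
  rw [Finset.sum_eq_single_of_mem m hm (fun p _ hp ↦ by simp [hp])]
  simp

/-- Quadratic form at a vector supported on two points `m ≠ n` with values `1` and `w`. -/
private theorem sum_sum_pair (s : Finset ι) (S : ι → ι → ℂ) {m n : ι} (hm : m ∈ s) (hn : n ∈ s)
    (hmn : m ≠ n) (w : ℂ) :
    ∑ p ∈ s, ∑ q ∈ s, (if p = m then 1 else if p = n then w else 0) *
        conj (if q = m then 1 else if q = n then w else 0) * S p q =
      S m m + w * conj w * S n n + conj w * S m n + w * S n m := by
  have hq : ∀ p : ι, ∑ q ∈ s, (if p = m then 1 else if p = n then w else 0) *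
      conj (if q = m then 1 else if q = n then w else 0) * S p q =
      (if p = m then 1 else if p = n then w else 0) * 1 * S p m +
        (if p = m then 1 else if p = n then w else 0) * conj w * S p n := by
    intro p
    rw [Finset.sum_eq_add_of_mem m n hm hn hmn (fun q _ hq ↦ by simp [hq.1, hq.2])]
    simp [hmn.symm]
  simp_rw [hq]
  rw [Finset.sum_eq_add_of_mem m n hm hn hmn (fun p _ hp ↦ by simp [hp.1, hp.2])]
  simp [hmn.symm]
  ring

/-- Real quadratic form of a real kernel at the same two-point vector. -/
private theorem sum_sum_pair_real (s : Finset ι) (G : ι → ι → ℝ) {m n : ι} (hm : m ∈ s) (hn : n ∈ s)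
    (hmn : m ≠ n) (w : ℂ) :
    ∑ q ∈ s, ∑ p ∈ s, (conj (if q = m then 1 else if q = n then w else 0) *
        (if p = m then 1 else if p = n then w else 0)).re * G q p =
      G m m + (conj w * w).re * G n n + w.re * G m n + w.re * G n m := by
  have hp : ∀ q : ι, ∑ p ∈ s, (conj (if q = m then 1 else if q = n then w else 0) *
      (if p = m then 1 else if p = n then w else 0)).re * G q p =
      (conj (if q = m then 1 else if q = n then w else 0) * 1).re * G q m +
        (conj (if q = m then 1 else if q = n then w else 0) * w).re * G q n := by
    intro q
    rw [Finset.sum_eq_add_of_mem m n hm hn hmn (fun p _ hp ↦ by simp [hp.1, hp.2])]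
    simp [hmn.symm]
  simp_rw [hp]
  rw [Finset.sum_eq_add_of_mem m n hm hn hmn (fun q _ hq ↦ by simp [hq.1, hq.2])]
  simp [hmn.symm, Complex.conj_re]
  ring

/-- **Polarisation.** Let `S` be a hermitian kernel (`S(q,p) = conj S(p,q)`) and `G` a real kernel on a
finite set `s` such that the real quadratic forms agree for every complex vector:
`Re Σ_{p,q} c_p conj(c_q) S(p,q) = Σ_{q,p} Re(conj c_q · c_p) G(q,p)`. Then every entry of `S` on `s` is
REAL. (Test vectors `δ_m`, `δ_n`, `δ_m + iδ_n`.) -/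
theorem im_eq_zero_of_re_hermitian_eq_real (s : Finset ι) {S : ι → ι → ℂ} {G : ι → ι → ℝ}
    (hS : ∀ p q, S q p = conj (S p q))
    (h : ∀ c : ι → ℂ, (∑ p ∈ s, ∑ q ∈ s, c p * conj (c q) * S p q).re =
      ∑ q ∈ s, ∑ p ∈ s, (conj (c q) * c p).re * G q p)
    {m n : ι} (hm : m ∈ s) (hn : n ∈ s) : (S m n).im = 0 := by
  by_cases hmn : m = n
  · subst hmn
    have hmm := hS m m
    have : (S m m).im = -(S m m).im := by
      conv_lhs => rw [hmm]
      rw [Complex.conj_im]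
    linarith
  -- diagonal entries from `δ_m`, `δ_n`
  have hdm : (S m m).re = G m m := by
    have h1 := h (fun p ↦ if p = m then 1 else 0)
    rw [sum_sum_single s S hm 1, sum_sum_single_real s G hm 1] at h1
    simpa using h1
  have hdn : (S n n).re = G n n := by
    have h1 := h (fun p ↦ if p = n then 1 else 0)
    rw [sum_sum_single s S hn 1, sum_sum_single_real s G hn 1] at h1
    simpa using h1
  -- the vector `δ_m + i δ_n`
  have h2 := h (fun p ↦ if p = m then 1 else if p = n then I else 0)
  rw [sum_sum_pair s S hm hn hmn I, sum_sum_pair_real s G hm hn hmn I, hS m n] at h2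
  simp only [Complex.add_re, Complex.mul_re, Complex.mul_im, Complex.conj_re, Complex.conj_im,
    Complex.I_re, Complex.I_im] at h2
  nlinarith [hdm, hdn, h2]

end Polar

/-! ## The Gram matrix on Yoshida's basis is real -/

variable {a : ℝ}

/-- **`weilWindowSesq a χ_m χ_n` is real** (`a > 0`): weil-2's explicit (real) entry theorem and weil-3's
sesquilinear Gram expansion describe the same quadratic form, so by polarisation the hermitian kernel
`weilWindowSesq a χ_· χ_·` has real entries. -/
theorem im_weilWindowSesq_chi (ha : 0 < a) (m n : ℤ) :
    (weilWindowSesq a (chi a m) (chi a n)).im = 0 := by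
  classical
  -- the explicit real kernel `G` of weil-2's entry theorem is read off by unification
  have hex : ∃ G : ℤ → ℤ → ℝ, ∀ c : ℤ → ℂ,
      (∑ p ∈ ({m, n} : Finset ℤ), ∑ q ∈ ({m, n} : Finset ℤ),
          c p * conj (c q) * weilWindowSesq a (chi a p) (chi a q)).re =
        ∑ q ∈ ({m, n} : Finset ℤ), ∑ p ∈ ({m, n} : Finset ℤ), (conj (c q) * c p).re * G q p :=
    ⟨_, fun c ↦ by
      rw [← weilWindowForm_sum_smul_eq_re ha.le {m, n} (fun p _ ↦ isWindowFunction_chi ha p) c a,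
        weilWindowForm_sum_smul_chi_eq_explicit ha {m, n} c]⟩
  obtain ⟨G, hG⟩ := hex
  exact im_eq_zero_of_re_hermitian_eq_real ({m, n} : Finset ℤ)
    (S := fun p q ↦ weilWindowSesq a (chi a p) (chi a q)) (G := G)
    (fun p q ↦ weilWindowSesq_conj_symm a (chi a p) (chi a q)) hG
    (Finset.mem_insert_self m {n}) (Finset.mem_insert_of_mem (Finset.mem_singleton_self n))

/-- The even sector basis has real Gram entries. -/
theorem im_weilWindowSesq_chiEven (ha : 0 < a) (i j : ℕ) :
    (weilWindowSesq a (chiEven a i) (chiEven a j)).im = 0 := by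
  have hreal := im_weilWindowSesq_chi ha
  have hE : ∀ k : ℕ, ∃ (s : Finset ℤ) (d : ℤ → ℝ), chiEven a k = ∑ p ∈ s, ((d p : ℝ) : ℂ) • chi a p := by
    intro k
    by_cases hk : k = 0
    · refine ⟨{0}, fun _ ↦ 1, ?_⟩
      simp [chiEven, hk]
    · classical
      refine ⟨{(k : ℤ), -(k : ℤ)}, fun _ ↦ 1 / Real.sqrt 2, ?_⟩
      have hne : (k : ℤ) ≠ -(k : ℤ) := by omega
      rw [Finset.sum_pair hne]
      unfold chiEven
      rw [if_neg hk, smul_add]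
  obtain ⟨s, d, hs⟩ := hE i
  obtain ⟨t, e, ht⟩ := hE j
  rw [hs, ht, weilWindowSesq_sum_left ha.le s (fun p _ ↦ isWindowFunction_chi ha p)
    (IsWindowFunction.sum t _ fun q _ ↦ isWindowFunction_chi ha q) _ a]
  rw [Complex.im_sum]
  refine Finset.sum_eq_zero fun p _ ↦ ?_
  rw [weilWindowSesq_sum_right ha.le t (fun q _ ↦ isWindowFunction_chi ha q) (isWindowFunction_chi ha p) _ a,
    Finset.mul_sum, Complex.im_sum]
  refine Finset.sum_eq_zero fun q _ ↦ ?_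
  rw [Complex.conj_ofReal, ← mul_assoc, ← Complex.ofReal_mul, Complex.im_ofReal_mul, hreal p q, mul_zero]

/-- The odd sector basis has real Gram entries. -/
theorem im_weilWindowSesq_chiOdd (ha : 0 < a) (i j : ℕ) :
    (weilWindowSesq a (chiOdd a i) (chiOdd a j)).im = 0 := by
  classical
  have hreal := im_weilWindowSesq_chi ha
  have hO : ∀ k : ℕ, ∃ (s : Finset ℤ) (d : ℤ → ℝ), chiOdd a k = ∑ p ∈ s, ((d p : ℝ) : ℂ) • chi a p := by
    intro k
    by_cases hk : k = 0
    · refine ⟨∅, fun _ ↦ 0, ?_⟩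
      simp [chiOdd, hk]
    · refine ⟨{(k : ℤ), -(k : ℤ)}, fun p ↦ if p = (k : ℤ) then 1 / Real.sqrt 2 else -(1 / Real.sqrt 2), ?_⟩
      have hne : (k : ℤ) ≠ -(k : ℤ) := by omega
      rw [Finset.sum_pair hne]
      funext x
      simp only [chiOdd, Pi.smul_apply, Pi.add_apply, Pi.sub_apply, smul_eq_mul, if_neg hne.symm]
      push_cast
      ring
  obtain ⟨s, d, hs⟩ := hO i
  obtain ⟨t, e, ht⟩ := hO j
  rw [hs, ht, weilWindowSesq_sum_left ha.le s (fun p _ ↦ isWindowFunction_chi ha p)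
    (IsWindowFunction.sum t _ fun q _ ↦ isWindowFunction_chi ha q) _ a]
  rw [Complex.im_sum]
  refine Finset.sum_eq_zero fun p _ ↦ ?_
  rw [weilWindowSesq_sum_right ha.le t (fun q _ ↦ isWindowFunction_chi ha q) (isWindowFunction_chi ha p) _ a,
    Finset.mul_sum, Complex.im_sum]
  refine Finset.sum_eq_zero fun q _ ↦ ?_
  rw [Complex.conj_ofReal, ← mul_assoc, ← Complex.ofReal_mul, Complex.im_ofReal_mul, hreal p q, mul_zero]

/-- **The sector-basis dictionary, reality discharged.** Let `a > 0` and let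
`G⁺(i,j) = weilWindowSesq a (chiEven a i) (chiEven a j)`, `G⁻(i,j) = weilWindowSesq a (chiOdd a i) (chiOdd a j)`.
If for every `N` the REAL quadratic forms `Σ_{i,j ≤ N} z_i·Re G⁺(i,j)·z_j` and
`Σ_{1 ≤ i,j ≤ N} z_i·Re G⁻(i,j)·z_j` are non-negative for all real `z`, then `WeilPositivityOn a`. -/
theorem weilPositivityOn_of_sectorBasis_psd (ha : 0 < a)
    (hev : ∀ (N : ℕ) (z : ℕ → ℝ), 0 ≤ ∑ i ∈ Finset.range (N + 1), ∑ j ∈ Finset.range (N + 1),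
      z i * (weilWindowSesq a (chiEven a i) (chiEven a j)).re * z j)
    (hod : ∀ (N : ℕ) (z : ℕ → ℝ), 0 ≤ ∑ i ∈ Finset.Icc 1 N, ∑ j ∈ Finset.Icc 1 N,
      z i * (weilWindowSesq a (chiOdd a i) (chiOdd a j)).re * z j) :
    WeilPositivityOn a :=
  weilPositivityOn_of_sectorBasis_real_gram_psd ha (im_weilWindowSesq_chiEven ha)
    (im_weilWindowSesq_chiOdd ha) hev hod

/-- **The real-Gram dictionary on Yoshida's basis, reality discharged** (`a > 0`). -/
theorem weilPositivityOn_of_gram_psd (ha : 0 < a)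
    (hpsd : ∀ (N : ℕ) (x : ℤ → ℝ),
      0 ≤ ∑ m ∈ modes N, ∑ n ∈ modes N, x m * x n * (weilWindowSesq a (chi a m) (chi a n)).re) :
    WeilPositivityOn a :=
  weilPositivityOn_of_real_gram_psd ha (im_weilWindowSesq_chi ha) hpsd

end Summit.RiemannHypothesis.RiemannHypothesis.Theorems.WeilFormatC

end
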